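import Mathlib
import Literature.Analysis.FluidPDE.VectorCalculus
import Summits.NavierStokesRegularity.NavierStokesRegularity.Theorems.ThreadingFluxErtelTowerStrainShadowOffAxes
import Summits.NavierStokesRegularity.NavierStokesRegularity.Theorems.ThreadingFluxErtelTowerStrainShadowAxesConnected
import HarnessLib

/-!
# Crux `PoloidalLiouville` (stmt-NavierStokesRegularity-1222, W1), crux idea «radial-jerk-tower» (ns-idea-15 g7):
# THE STRAIN SHADOW, VI — the GLOBAL classification (`StrainShadowClassification` BY NAME) and the bounded-class
# Liouville corollary (`StrainShadowLiouville` BY NAME)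

Support file (`--supports stmt-NavierStokesRegularity-1222`, helper).  Experiment cell `ns-wall-extremal`, width hand
ns-wall-eng-5 g7 (successor of g6), director KEY-NS #186 / director-ns g18 06:48:57Z («GLOBAL → Liouville»); critic of
record ns-wall-crit-1 g5 (V21-P2).  0 kit.

The two remaining provable Props of `ErtelTowerSketch.lean` v1.1 Part B (Defs twin p692432), closed BY NAME:

* ★★ `strainShadowClassification : StrainShadowClassification` — the conclusion of `StrainShadowClassificationLocal`
  (p703263) on EVERY preconnected open `I × U`, the principal planes AND the principal axes included.
* ★ `strainShadowLiouville : StrainShadowLiouville` — in the bounded class on `I × ℝ³` the viscous strain shadow is empty.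

## Proof (globalisation at the axis points)

The off-axes theorem `strainShadowClassification_offAxes` (p703530) gives ONE constant `C` on `I × (U ∩ {τ ≠ 0})` as soon as
`U ∩ {τ ≠ 0}` is preconnected — and it is, for every preconnected open `U`: the zero set of `τ = Sx × x` (pairwise distinct
strains) is the union of the three principal AXES, and removing it separates nothing
(`isPreconnected_inter_topField_ne_zero`, file `…StrainShadowAxesConnected`: the tree's local-to-global point-set lemma
`Literature.Topology.FourManifolds.isPreconnected_of_forall_nhds` in the subtype `U`, fed with star-convex «sign pieces»
covering a ball minus the axes).  Then `B(t,·) = C·exp(xᵀSx/2ν)·τ` extends from the dense open set `U ∩ {τ ≠ 0}` to the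
axis points of `U` by continuity of `B(t,·)` on `U` (both sides vanish there).
The Liouville corollary: on `I × ℝ³` the classification holds with `U = univ`; along the ray `λ(1,1,1)` one has
`xᵀSx = λ²(a+b+c) = 0` and `τ = λ²(b−c, c−a, a−b) ≠ 0`, so `‖B(t, λ(1,1,1))‖ = |C|·λ²·‖τ(1,1,1)‖` is bounded in `λ` only if
`C = 0` — boundedness is killed by SCALING alone.

BOOKING (critic's words, V21-P1/P2/P4): statements about the LINEAR STRAIN SHADOW (prescribed drift `Sx`) — not
⟨1222⟩/⟨27585⟩; helpers, W1 movement 0; `StrainShadowSurvivor` (p695047) shows boundedness is load-bearing.  With this file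
ELEVEN of the twelve Part B Props are Theorems-side by name; `PotentialJerkRigidity` is a CONJECTURE and is not touched.
`PoloidalLiouville` (1222) / (27585) OPEN; NS regularity NOT proved.
-/

-- the summit and its single problem share the name (D-0017 nested layout)
set_option linter.dupNamespace false

noncomputable section

namespace Summit.NavierStokesRegularity.NavierStokesRegularity.Theorems.PoloidalLiouville.ErtelTower

open Set Function Filter Topology Metric
open scoped Topology RealInnerProductSpace InnerProductSpace
open Literature.Analysis.FluidPDE
open Summit.NavierStokesRegularity.NavierStokesRegularity.Theorems.PoloidalLiouville.HorizonTower (E3)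

/-! ### The global classification and the Liouville corollary, BY NAME -/

section Global

/-- ★★ **GLOBAL VISCOUS STRAIN-SHADOW CLASSIFICATION** (`ErtelTowerSketch` v1.1 Part B, BY NAME).  Let `ν > 0` and
`S = diag(a,b,c)` be trace-free with pairwise distinct entries.  Every smooth divergence-free solution of
`∂ₜB + (Sx·∇)B − SB = νΔB` on a preconnected open `I × U` that is tangent to the spheres about the centre is
`B(t,x) = C · exp(xᵀSx / 2ν) · (Sx × x)` for ONE constant `C` — `U` arbitrary (it may contain the principal planes and
axes).  Proof: `strainShadowClassification_offAxes` on the preconnected open `I × (U ∩ {τ ≠ 0})`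
(`isPreconnected_inter_topField_ne_zero`), then extension to the axis points of `U` by continuity of `B(t,·)` and density of
`{τ ≠ 0}` (both sides vanish on the axes). -/
theorem strainShadowClassification : StrainShadowClassification := by
  intro ν a b c B I U hν hab hbc hca htr hI hIc hU hUc hB hdiv heq htan
  set U' : Set E3 := U ∩ {y : E3 | topField a b c y ≠ 0} with hU'def
  have hU'o : IsOpen U' := hU.inter isOpen_topField_ne_zero
  have hU'c : IsPreconnected U' := isPreconnected_inter_topField_ne_zero hab hbc hca hU hUc
  have hsub : U' ⊆ U := inter_subset_left
  obtain ⟨C, hC⟩ := strainShadowClassification_offAxes ν a b c B I U' hν hab hbc hca htr hI hIc hU'o hU'c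
    (fun y hy => hy.2) (hB.mono (prod_mono le_rfl hsub)) (fun t ht y hy => hdiv t ht y (hsub hy))
    (fun t ht y hy => heq t ht y (hsub hy)) (fun t ht y hy => htan t ht y (hsub hy))
  refine ⟨C, fun t ht x hx => ?_⟩
  have hclos : x ∈ closure U' := (dense_topField_ne_zero (a := a) hbc).open_subset_closure_inter hU hx
  set f : E3 → E3 := fun y => B t y - (C * Real.exp (quadForm a b c y / (2 * ν))) • topField a b c y with hfdef
  have hfc : ContinuousOn f U := by
    refine (contDiffOn_slice hB ht).continuousOn.sub (Continuous.continuousOn ?_)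
    exact (continuous_const.mul ((contDiff_quadForm a b c (n := 0)).continuous.div_const _).rexp).smul
      (contDiff_topField a b c (n := 0)).continuous
  have hmaps : MapsTo f U' {0} := fun y hy => by
    simp only [hfdef, mem_singleton_iff, hC t ht y hy, sub_self]
  have hmem := ((hfc x hx).mono hsub).mem_closure hclos hmaps
  rw [closure_singleton, mem_singleton_iff] at hmem
  exact sub_eq_zero.mp hmem

/-- `xᵀSx` is a quadratic form: `q(λx) = λ² q(x)`. -/
theorem quadForm_smul (a b c r : ℝ) (x : E3) : quadForm a b c (r • x) = r ^ 2 * quadForm a b c x := by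
  simp only [quadForm, PiLp.smul_apply, smul_eq_mul]
  ring

/-- `τ = Sx × x` is quadratic: `τ(λx) = λ² τ(x)`. -/
theorem topField_smul (a b c r : ℝ) (x : E3) : topField a b c (r • x) = r ^ 2 • topField a b c x := by
  ext i
  fin_cases i <;> simp [topField] <;> ring

/-- On the diagonal `(1,1,1)`: `q = a + b + c` and `τ = (b − c, c − a, a − b)`, so `‖τ‖ ≠ 0` for `b ≠ c`. -/
theorem quadForm_diag (a b c : ℝ) : quadForm a b c (WithLp.toLp 2 ![1, 1, 1]) = a + b + c := by
  simp [quadForm]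

/-- `τ(1,1,1) ≠ 0` for `b ≠ c`. -/
theorem topField_diag_ne_zero {a b c : ℝ} (hbc : b ≠ c) : topField a b c (WithLp.toLp 2 ![1, 1, 1]) ≠ 0 := by
  intro h
  have h0 : topField a b c (WithLp.toLp 2 ![1, 1, 1]) 0 = 0 := by rw [h]; rfl
  rw [(topField_apply a b c _).1] at h0
  simp only [Matrix.cons_val_one, Matrix.cons_val_zero, mul_one] at h0
  exact hbc (sub_eq_zero.mp (by simpa using h0))

/-- ★ **STRAIN-SHADOW LIOUVILLE** (`ErtelTowerSketch` v1.1 Part B, BY NAME): in the bounded class the viscous strain shadow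
is EMPTY — a bounded smooth divergence-free sphere-tangent solution of the passive viscous equation in a trace-free triaxial
strain on `I × ℝ³` vanishes identically.  Proof: the global classification on `U = univ` gives
`B = C·exp(xᵀSx/2ν)·τ`; along the ray `λ(1,1,1)` the exponent is `λ²(a+b+c)/2ν = 0` and `τ = λ²(b−c, c−a, a−b)`, so
`‖B(t, λ(1,1,1))‖ = |C|·λ²·‖τ(1,1,1)‖` is bounded in `λ ∈ ℕ` only if `C = 0`.  (Boundedness is load-bearing:
`strainShadowSurvivor`, p695047.) -/
theorem strainShadowLiouville : StrainShadowLiouville := by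
  intro ν a b c B I hν hab hbc hca htr hI hIc hB hdiv heq htan hbdd t ht x
  obtain ⟨C, hC⟩ := strainShadowClassification ν a b c B I univ hν hab hbc hca htr hI hIc isOpen_univ
    isPreconnected_univ hB (fun s hs y _ => hdiv s hs y) (fun s hs y _ => heq s hs y) (fun s hs y _ => htan s hs y)
  obtain ⟨M, hM⟩ := hbdd
  set d : E3 := WithLp.toLp 2 ![1, 1, 1] with hddef
  have hτ : 0 < ‖topField a b c d‖ := norm_pos_iff.mpr (topField_diag_ne_zero hbc)
  -- along the ray: `B(t, n•d) = (C n²) • τ(d)`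
  have hray : ∀ n : ℕ, ‖B t ((n : ℝ) • d)‖ = |C| * (n : ℝ) ^ 2 * ‖topField a b c d‖ := by
    intro n
    rw [hC t ht _ (mem_univ _), quadForm_smul, hddef, quadForm_diag, htr, mul_zero, zero_div, Real.exp_zero, mul_one,
      topField_smul, smul_smul, norm_smul, Real.norm_eq_abs, abs_mul, abs_of_nonneg (sq_nonneg (n : ℝ))]
  have hC0 : C = 0 := by
    by_contra hC0
    have hpos : 0 < |C| * ‖topField a b c d‖ := mul_pos (abs_pos.mpr hC0) hτ
    obtain ⟨n, hn⟩ := exists_nat_gt (M / (|C| * ‖topField a b c d‖) + 1)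
    have hle : ‖B t ((n : ℝ) • d)‖ ≤ M := hM t ht _
    rw [hray n] at hle
    have hn1 : (1 : ℝ) ≤ n := by
      have : (0 : ℝ) ≤ M / (|C| * ‖topField a b c d‖) := by
        have hM0 : 0 ≤ M := (norm_nonneg _).trans (hM t ht x)
        positivity
      linarith
    have hsq : (n : ℝ) ≤ (n : ℝ) ^ 2 := by nlinarith
    have h1 : M < (n : ℝ) * (|C| * ‖topField a b c d‖) := by
      have := (div_lt_iff₀ hpos).mp (by linarith : M / (|C| * ‖topField a b c d‖) < n)
      linarith
    nlinarith [mul_le_mul_of_nonneg_right hsq hpos.le]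
  rw [hC t ht x (mem_univ _), hC0, zero_mul, zero_smul]

end Global

end Summit.NavierStokesRegularity.NavierStokesRegularity.Theorems.PoloidalLiouville.ErtelTower
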